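import Summits.HodgeConjecture.HodgeConjecture.Theses.PadicSemiregularLift
import Literature.AlgebraicGeometry.Modules.LocalFrames

/-!
# Round-2 ideator 6 — first lemmas for crux stmt-HodgeConjecture-13825 `FormalLiftingFromClassLifting`

Two crux idea cards (round 2):

* `dual-bundle-parity`   — §1: the duality involution `E ↦ E^∨` on the `K₀`-tower (typed as an
  existence statement over the tree's `KZero` and `Modules.dual`), its algebraic core
  (`oddShift_eq_zero`: an odd weight-shift between groups on which an involution acts by the weight
  signs vanishes when the target has no `2`-torsion), and the kernel-checked index bookkeeping
  (`parityWindow_four`: for `d ≤ 4` every differential from a kernel piece of weight `r ≥ 2` into an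
  obstruction piece has ODD shift).
* `genuine-relative-k0` — §2: the "Bass double" `𝒳 ⊗_W (W_{m+1} ×_k W_{m+1})`, an honest scheme
  (existing carriers only) whose vector bundles are Bass–Heller pairs `(F, F', φ : F|X_k ≅ F'|X_k)`;
  the first lemma `KernelClassesFromDouble` (every kernel class of `K₀(X_{m+1}) → K₀(X_k)` is the
  first-sheet shadow of a class on the double dying on the second sheet — Milnor patching +
  Land–Tamme excision at `K₀`), and Heller's criterion `HellerCriterion` for equality of classes in
  the tree's `KZero` (Grayson arXiv:1310.8644, Lemma p. 8).

Nothing here is a proof of the crux; these are the typed first statements the cards point to.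
-/

set_option linter.dupNamespace false

namespace Summit.HodgeConjecture.HodgeConjecture.Cruxes.FormalLiftingFromClassLifting.IdeatorSix

open CategoryTheory AlgebraicGeometry Limits
open Literature.AlgebraicGeometry
open Literature.AlgebraicGeometry.Motives Literature.AlgebraicGeometry.Motives.WittScheme
open Summit.HodgeConjecture.HodgeConjecture.Theses.PadicSemiregularLift

noncomputable section

/-! ## §1. Card `dual-bundle-parity` -/

section Parity

variable {p : ℕ} [Fact p.Prime] {k : Type} [Field k] [CharP k p] [PerfectRing k p]
variable (𝒳 : SchemeOver (WittVector p k))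

/-- **The duality involution on the `K₀`-tower** (first lemma of card `dual-bundle-parity`): there are
additive involutions `D_n` of `K₀(X_{n+1})` and `D_k` of `K₀(X_k)` sending the class of a finite
locally free `E` to the class of its dual `E^∨ = 𝓗om(E, 𝒪)` (tree `Modules.dual`), commuting with
the restriction maps of the tower. (`ψ^{-1}` of the `λ`-ring `K₀`; exact duality functor on `Vect`.)
Paper status: folklore (dual of a short exact sequence of vector bundles is short exact; pull-back
commutes with duals of finite locally free modules). -/
def HasDualityInvolution : Prop :=
  ∃ (D : ∀ n : ℕ, KTheory.KZero (thickening 𝒳 (n + 1)).left →+ KTheory.KZero (thickening 𝒳 (n + 1)).left)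
    (Dk : KTheory.KZero (specialFibre 𝒳).left →+ KTheory.KZero (specialFibre 𝒳).left),
    (∀ n x, D n (D n x) = x) ∧ (∀ x, Dk (Dk x) = x) ∧
    (∀ n, (D n).comp (KTheory.KZero.map (thickeningMap 𝒳 (Nat.le_succ (n + 1)))) =
      (KTheory.KZero.map (thickeningMap 𝒳 (Nat.le_succ (n + 1)))).comp (D (n + 1))) ∧
    (∀ n, Dk.comp (KTheory.KZero.map (specialFibreToThickening 𝒳 n)) =
      (KTheory.KZero.map (specialFibreToThickening 𝒳 n)).comp (D n)) ∧
    (∀ n (E : (thickening 𝒳 (n + 1)).left.Modules) (hE : IsFiniteLocallyFree E),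
      ∃ hE' : IsFiniteLocallyFree (Modules.dual E),
        D n (KTheory.KZero.of E hE) = KTheory.KZero.of (Modules.dual E) hE')

/-- **Kernel and cokernel groups of the tower inherit the involution** (the shape in which the card
uses it): an additive endomorphism of two groups commuting with a map between them induces
endomorphisms of the kernel and of the cokernel. Trivial; recorded to fix the statement. -/
theorem ker_coker_inherit {A B : Type*} [AddCommGroup A] [AddCommGroup B] (f : A →+ B)
    (DA : A →+ A) (DB : B →+ B) (h : DB.comp f = f.comp DA) :
    (∀ a ∈ f.ker, DA a ∈ f.ker) ∧ (∀ b ∈ f.range, DB b ∈ f.range) := by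
  constructor
  · intro a ha
    rw [AddMonoidHom.mem_ker] at ha ⊢
    have := congrArg (fun g => g a) h
    simp only [AddMonoidHom.coe_comp, Function.comp_apply] at this
    rw [← this, ha, map_zero]
  · rintro b ⟨a, rfl⟩
    refine ⟨DA a, ?_⟩
    have := congrArg (fun g => g a) h
    simpa only [AddMonoidHom.coe_comp, Function.comp_apply] using this.symm

/-- **The algebraic core of the parity lever.** Let `d : A → B` be additive and equivariant for
involutions acting on `A` by the sign `(-1)^r` and on `B` by the sign `(-1)^(r+s)` (pure Adams
weights `r` and `r + s`). If the shift `s` is ODD and `B` has no `2`-torsion (e.g. `B` is `p`-primary,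
`p` odd), then `d = 0`. In the card: `A` = a kernel (`π₀`) piece of weight `r`, `B` = an obstruction
(`π₋₁`) piece of weight `r + s`, the involution = duality `E ↦ E^∨`, `d` = a differential of the
weight spectral sequence of the relative `K`-theory of the thickening. -/
theorem oddShift_eq_zero {A B : Type*} [AddCommGroup A] [AddCommGroup B] (d : A →+ B)
    (ιA : A →+ A) (ιB : B →+ B) (r s : ℕ)
    (hA : ∀ a, ιA a = ((-1 : ℤ) ^ r) • a) (hB : ∀ b, ιB b = ((-1 : ℤ) ^ (r + s)) • b)
    (hd : ∀ a, d (ιA a) = ιB (d a)) (hs : Odd s) (h2 : ∀ b : B, 2 • b = 0 → b = 0) :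
    d = 0 := by
  ext a
  have key := hd a
  rw [hA, hB, map_zsmul, pow_add, hs.neg_one_pow, mul_neg, mul_one, neg_smul] at key
  -- key : (-1)^r • d a = -((-1)^r • d a)
  have h2' : 2 • (((-1 : ℤ) ^ r) • d a) = 0 := by
    rw [two_nsmul]
    nth_rewrite 2 [key]
    exact add_neg_cancel _
  have hzero : ((-1 : ℤ) ^ r) • d a = 0 := h2 _ h2'
  have : d a = ((-1 : ℤ) ^ r) • (((-1 : ℤ) ^ r) • d a) := by
    rw [smul_smul, ← pow_add, ← two_mul, pow_mul, neg_one_sq, one_pow, one_smul]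
  rw [this, hzero, smul_zero, AddMonoidHom.zero_apply]

/-- **Index bookkeeping for `d ≤ 4` (kernel-checked).** In the weight spectral sequence of the
relative `K`-theory of `(X_m, X_1)` for a `d`-fold, a kernel piece `π₀ grʳ` can be non-zero only if
some column `j ≤ min(r-1, d)` has degree `2r-1-j ≤ d`, and an obstruction piece `π₋₁ gr^{r'}` only if
some `j' ≤ min(r'-1, d)` has `2r'-j' ≤ d`. For `d ≤ 4`, EVERY differential `π₀ grʳ → π₋₁ gr^{r'}`
(`r' > r`) whose source is not the weight-one (line bundle, permanent) piece has ODD shift `r' - r`;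
hence duality kills it (`oddShift_eq_zero`). For `d = 5` the statement fails (`r = 2`, `r' = 4`),
which is exactly where the card stops claiming anything. -/
theorem parityWindow_four :
    ∀ d ∈ Finset.range 5, ∀ r ∈ Finset.range 12, ∀ r' ∈ Finset.range 12,
      2 ≤ r → r < r' →
      (∃ j ∈ Finset.range 12, j + 1 ≤ r ∧ j ≤ d ∧ 2 * r ≤ d + 1 + j) →
      (∃ j' ∈ Finset.range 12, j' + 1 ≤ r' ∧ j' ≤ d ∧ 2 * r' ≤ d + j') →
      (r' - r) % 2 = 1 := by
  decide

/-- The `d = 5` counterexample to the same bookkeeping (an EVEN shift survives: weight `2 → 4`,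
target column `j' = 3`, degree `5`), recorded so that nobody extends the card's claim past `d = 4`. -/
theorem parityWindow_five_fails :
    ∃ r r' j j', 2 ≤ r ∧ r < r' ∧ j + 1 ≤ r ∧ j ≤ 5 ∧ 2 * r ≤ 5 + 1 + j ∧
      j' + 1 ≤ r' ∧ j' ≤ 5 ∧ 2 * r' ≤ 5 + j' ∧ (r' - r) % 2 = 0 :=
  ⟨2, 4, 0, 3, by decide⟩

end Parity

/-! ## §2. Card `genuine-relative-k0`: the Bass double and Heller's criterion -/

section Double

variable (p : ℕ) [Fact p.Prime] (k : Type) [Field k] [CharP k p] [PerfectRing k p]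

/-- The two residue maps `W_{m+1} × W_{m+1} → k`. -/
def resFst (m : ℕ) : wittQuot p k (m + 1) × wittQuot p k (m + 1) →+* k :=
  (wittQuotToResidue p k m).comp (RingHom.fst _ _)

/-- The two residue maps `W_{m+1} × W_{m+1} → k`. -/
def resSnd (m : ℕ) : wittQuot p k (m + 1) × wittQuot p k (m + 1) →+* k :=
  (wittQuotToResidue p k m).comp (RingHom.snd _ _)

/-- **The double base ring** `R_m = W_{m+1} ×_k W_{m+1} = {(a, b) : a ≡ b mod p}`, a local Artinian
`W`-algebra with residue field `k`; `R_0 = k`. (For `𝒳` flat over `W`,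
`𝒳 ⊗_W R_m = X_{m+1} ⊔_{X_k} X_{m+1}` is the DOUBLE of the thickening along the special fibre.) -/
def doubleBase (m : ℕ) : Subring (wittQuot p k (m + 1) × wittQuot p k (m + 1)) :=
  RingHom.eqLocus (resFst p k m) (resSnd p k m)

/-- The structure map `W → R_m`, `a ↦ (ā, ā)`. -/
def toDoubleBase (m : ℕ) : WittVector p k →+* doubleBase p k m :=
  RingHom.codRestrict
    ((algebraMap (WittVector p k) (wittQuot p k (m + 1))).prod
      (algebraMap (WittVector p k) (wittQuot p k (m + 1))))
    (doubleBase p k m) (fun a => by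
      change resFst p k m _ = resSnd p k m _
      rfl)

/-- The two sheet projections `R_m → W_{m+1}`. -/
def sheetFst (m : ℕ) : doubleBase p k m →+* wittQuot p k (m + 1) :=
  (RingHom.fst _ _).comp (doubleBase p k m).subtype

/-- The two sheet projections `R_m → W_{m+1}`. -/
def sheetSnd (m : ℕ) : doubleBase p k m →+* wittQuot p k (m + 1) :=
  (RingHom.snd _ _).comp (doubleBase p k m).subtype

theorem sheetFst_comp_toDoubleBase (m : ℕ) :
    (sheetFst p k m).comp (toDoubleBase p k m) = algebraMap (WittVector p k) (wittQuot p k (m + 1)) :=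
  RingHom.ext fun _ => rfl

theorem sheetSnd_comp_toDoubleBase (m : ℕ) :
    (sheetSnd p k m).comp (toDoubleBase p k m) = algebraMap (WittVector p k) (wittQuot p k (m + 1)) :=
  RingHom.ext fun _ => rfl

variable {p k}
variable (𝒳 : SchemeOver (WittVector p k))

/-- **The Bass double** `D_m = 𝒳 ⊗_W R_m` of the thickening `X_{m+1}` along `X_k`: an honest
scheme over `R_m`, built from existing carriers (`Motives.baseChangeHom`). Its vector bundles are the
Bass–Heller pairs `(F, F', φ : F|X_k ≅ F'|X_k)` of vector bundles on `X_{m+1}` (Milnor patching,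
Ferrand 2003), so `K₀(D_m)` is an existing-carrier avatar of the generators of relative `K₀`. -/
def BassDouble (m : ℕ) : SchemeOver (doubleBase p k m) :=
  (baseChangeHom (toDoubleBase p k m)).obj 𝒳

/-- The first sheet `X_{m+1} ⟶ D_m` (closed immersion induced by `R_m → W_{m+1}`, `(a,b) ↦ a`). -/
def sheet₁ (m : ℕ) : (thickening 𝒳 (m + 1)).left ⟶ (BassDouble 𝒳 m).left :=
  pullback.map 𝒳.hom
    (Spec.map (CommRingCat.ofHom (algebraMap (WittVector p k) (wittQuot p k (m + 1)))))
    𝒳.hom (Spec.map (CommRingCat.ofHom (toDoubleBase p k m)))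
    (𝟙 _) (Spec.map (CommRingCat.ofHom (sheetFst p k m))) (𝟙 _)
    (by rw [Category.comp_id, Category.id_comp])
    (by rw [Category.comp_id, ← Spec.map_comp, ← CommRingCat.ofHom_comp, sheetFst_comp_toDoubleBase])

/-- The second sheet `X_{m+1} ⟶ D_m` (induced by `(a,b) ↦ b`). -/
def sheet₂ (m : ℕ) : (thickening 𝒳 (m + 1)).left ⟶ (BassDouble 𝒳 m).left :=
  pullback.map 𝒳.hom
    (Spec.map (CommRingCat.ofHom (algebraMap (WittVector p k) (wittQuot p k (m + 1)))))
    𝒳.hom (Spec.map (CommRingCat.ofHom (toDoubleBase p k m)))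
    (𝟙 _) (Spec.map (CommRingCat.ofHom (sheetSnd p k m))) (𝟙 _)
    (by rw [Category.comp_id, Category.id_comp])
    (by rw [Category.comp_id, ← Spec.map_comp, ← CommRingCat.ofHom_comp, sheetSnd_comp_toDoubleBase])

/-- **First lemma of card `genuine-relative-k0`: kernel classes come from the double.** Every class
of `K₀(X_{m+1})` dying on `X_k` is the first-sheet restriction of a class on the Bass double `D_m`
whose second-sheet restriction is zero. Paper proof: `K₀(D_m) → K₀(X_{m+1}) ×_{K₀(X_k)} K₀(X_{m+1})`
is onto (Land–Tamme, *On the K-theory of pullbacks*, Ann. Math. 190 (2019), Thm A: the square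
`K(D_m); K(X_{m+1}), K(X_{m+1}); K(𝒪_{X_{m+1}} ⊙ 𝒪_{X_{m+1}})` is cartesian, `K₀` of the connective
`⊙`-ring is `K₀(X_k)`; Zariski descent globalises; for affine `X` this is Milnor 1971 §2), applied to
the pair `(t, 0)`. A TRUE `K₀`-level statement over existing carriers, new to the crux. -/
def KernelClassesFromDouble : Prop :=
  ∀ (m : ℕ) (t : KTheory.KZero (thickening 𝒳 (m + 1)).left),
    KTheory.KZero.map (specialFibreToThickening 𝒳 m) t = 0 →
    ∃ τ : KTheory.KZero (BassDouble 𝒳 m).left,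
      KTheory.KZero.map (sheet₁ 𝒳 m) τ = t ∧ KTheory.KZero.map (sheet₂ 𝒳 m) τ = 0

/-- (2_K) **kernel-tower surjectivity**, verbatim the disprover's `Disproof.KernelTowerSurjective`
(= registered stub `stub_kernelTowerSurjective` of the dead line `pro-class-correction-syntomic`),
restated here only to avoid importing the crux workfile. -/
def KernelTowerSurjective : Prop :=
  ∀ (n : ℕ) (t : KTheory.KZero (thickening 𝒳 (n + 1)).left),
    KTheory.KZero.map (specialFibreToThickening 𝒳 n) t = 0 →
    ∃ t' : KTheory.KZero (thickening 𝒳 (n + 2)).left,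
      KTheory.KZero.map (specialFibreToThickening 𝒳 (n + 1)) t' = 0 ∧
      KTheory.KZero.map (thickeningMap 𝒳 (Nat.le_succ (n + 1))) t' = t

/-- **Kernel-tower surjectivity follows from lifting anti-symmetric double classes** (the reshaped
(2_K) the card proposes; a consequence shape, stated, not proved here): if every class on `D_m` dying
on the second sheet is the restriction of a class on `D_{m+1}` dying on the second sheet, then
`KernelTowerSurjective` holds. The double-tower transition `D_m → D_{m+1}` is the base change of
`R_{m+1} → R_m`; it is not typed here (same `pullback.map` pattern), so this def only records the
`K₀(X)`-side conclusion it must feed. -/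
def DoubleFeedsKernelTower : Prop :=
  KernelClassesFromDouble 𝒳 → KernelTowerSurjective 𝒳

end Double

section Heller

variable {X : Scheme.{0}}

/-- **Heller's criterion in the tree's `KZero`** (Grayson arXiv:1310.8644, Lemma p. 8; Heller 1965):
two finite locally free modules have the same class in `K₀(X)` iff there are finite locally free
`V⁰, V¹, V²` and short exact sequences `0 → E ⊞ V⁰ → V¹ → V² → 0`, `0 → E' ⊞ V⁰ → V¹ → V² → 0`.
This is how every computation "in `K₀`" of the crux chain (certificates that a class dies on `X_k`)
becomes a statement about OBJECTS; it is the `K₀`-part of the generators-and-relations presentation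
of relative `K`-theory the card asks to build. Provable now (free abelian group modulo relations). -/
def HellerCriterion : Prop :=
  ∀ (E E' : X.Modules) (hE : IsFiniteLocallyFree E) (hE' : IsFiniteLocallyFree E'),
    KTheory.KZero.of E hE = KTheory.KZero.of E' hE' ↔
      ∃ (V₀ V₁ V₂ : X.Modules) (_ : IsFiniteLocallyFree V₀) (_ : IsFiniteLocallyFree V₁)
        (_ : IsFiniteLocallyFree V₂) (S S' : ShortComplex X.Modules),
        S.ShortExact ∧ S'.ShortExact ∧
        Nonempty (S.X₁ ≅ E ⊞ V₀) ∧ Nonempty (S.X₂ ≅ V₁) ∧ Nonempty (S.X₃ ≅ V₂) ∧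
        Nonempty (S'.X₁ ≅ E' ⊞ V₀) ∧ Nonempty (S'.X₂ ≅ V₁) ∧ Nonempty (S'.X₃ ≅ V₂)

end Heller

end

end Summit.HodgeConjecture.HodgeConjecture.Cruxes.FormalLiftingFromClassLifting.IdeatorSix
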